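import Summits.Ventures.PercRepro.Night2TwoOneLossless

/-!
# PercRepro — the cell `(2, 1)` at `|V| ≤ 8` has no thin member (night-2, gen 28)

A thin member of a rank-`6` flat of the cell `(2, 1)` has `≥ 5` points and a spanning complement with `≥ 5` points,
so `|G| ≥ 10` and `|V| ≥ 9` (`thinMembers_eq_empty_of_small`); hence (LI_G) is trivial at `|V| ≤ 8`
(`localShadowHall_of_small`).
-/

namespace PercRepro.Shadow

open Finset PerFlat ThmH

variable {α : Type*} [DecidableEq α] {M : Matroid α} [M.Finite]

section Small

variable {G : Finset α}

/-- A flat of the cell `(2, 1)` with `|V| ≤ 8` has no thin member: a thin member and its complement both have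
`≥ 5` points. -/
theorem thinMembers_eq_empty_of_small (hG : G ∈ flatsQ M (5 + 1)) (hd : (gr M \ G).card = 2)
    (hk : kColoops M G = 1) (h8 : (G \ coloops M G).card ≤ 8) : thinMembers M 5 G = ∅ := by
  rw [Finset.eq_empty_iff_forall_notMem]
  intro B hB
  have hB' : B ∈ membersIn M (Uq M (5 + 2) 5) G := (mem_thinMembers.1 hB).1
  have hBU : B ∈ Uq M (5 + 2) 5 := (mem_membersIn.1 hB').1
  have hBG : B ⊆ G := (subset_clF hBU).trans (mem_membersIn.1 hB').2
  have h5 := five_le_rkN_sdiff_of_mem_Uq_two hG hd hBU hBG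
  have h5' : 5 ≤ (G \ B).card := (rkN_le_card (M := M) (G \ B)).trans' h5
  have hB5 : 5 ≤ B.card := by
    have := rkN_le_card (M := M) B
    rw [rkN_eq_five_of_mem_thinMembers hB] at this
    exact this
  have hKG : coloops M G ⊆ G := fun y hy => (mem_coloops.1 hy).1
  have hK1 : (coloops M G).card = 1 := by rw [← kColoops_eq_card_coloops]; exact hk
  have h1 := Finset.card_sdiff_of_subset hBG
  have h2 := Finset.card_sdiff_of_subset hKG
  have h3 := Finset.card_le_card hBG
  have h4 := Finset.card_le_card hKG
  omega

open scoped Classical in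
/-- **(LI_G) AT `|V| ≤ 8`**: no thin member, hence no loss. -/
theorem localShadowHall_of_small (hG : G ∈ flatsQ M (5 + 1)) (hd : (gr M \ G).card = 2)
    (hk : kColoops M G = 1) (h8 : (G \ coloops M G).card ≤ 8) : LocalShadowHall M 5 G := by
  apply localShadowHall_of_loss_eq_zero hG (by omega)
  intro B hB
  rw [thinMembers_eq_empty_of_small hG hd hk h8] at hB
  exact absurd hB (Finset.notMem_empty B)


end Small

end PercRepro.Shadow
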